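import Summits.QuantumAdvantage.QuantumAdvantage.Theorems.LinnikCubicClassGroupsDegreeOnePrimesEscapeDivisionPNTPiWindow
import HarnessLib

/-!
# The division prime number theorem for any prime predicate that agrees with the Frobenius condition at
# the unramified primes

Topic `Summits/QuantumAdvantage/QuantumAdvantage/Theorems`, cell B2b-1 (linnik-cubic), PART A (gen 11);
helper toward the crux `DegreeOnePrimesEscape` (stmt-QuantumAdvantage-11543) of route
`LinnikCubicClassGroups`.  HONEST FRAMING: the value of this file is a THEOREM (kernel-checked, GRH-free,
Siegel-free, no hypothesis) — NOT summit progress.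

`division_PNT_pi_window` counts the primes `p ≤ x` with `p ∤ d_N` whose Frobenius lies in the division
`Div σ`.  Consumers count primes by an arithmetic condition `P(p)` (a splitting type in a subfield, a
residue condition, …) which agrees with the Frobenius condition only at the primes `p ∤ d_N`.  Since at most
`log|d_N|/log 2` primes divide `d_N`, and the main term is `≫ x |d_N|^{−2(1+n²)}/log x` even at the
exceptional zero (Stark, `exceptional_mainTerm_ge`), the ramified primes are absorbed into the relative
error in the Linnik range `x ≥ |d_N|^{L}`:

* `division_PNT_pi_congr` — for `n > 1`, `0 < ε ≤ 1`, `c' > 0` there are `L > 0`, `0 < c ≤ min c' (1/4)` such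
  that for every Galois `N` of degree `n`, every `σ`, and EVERY predicate `P` on primes with
  `P(p) ↔ Frob_p ∈ Div σ` for all primes `p ∤ d_N`, the three-case conclusion of `division_PNT_pi_window`
  holds for `π_P(x) = #{p ≤ x : P(p)}`.
[cite: LagariasMontgomeryOdlyzko1979, Theorem 1.1] [cite: ThornerZaman2019, Theorem 1.4]
-/

noncomputable section

open scoped NumberField nonZeroDivisors
open Finset Real Ideal NumberField MeasureTheory Set
open Literature.NumberTheory.NumberFields Literature.NumberTheory.LFunctions
  Literature.NumberTheory.LFunctions.NumberField Literature.NumberTheory.LFunctions.AbelianDensity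

namespace Summit.QuantumAdvantage.QuantumAdvantage.Theorems.DegreeOnePrimesEscape

/-! ### Counting lemmas -/

/-- **Few primes divide the discriminant**: `#{p ≤ m prime : p ∣ d_N} ≤ 2 log|d_N|`. -/
theorem card_filter_primesLE_dvd_discr_le (N : Type*) [Field N] [NumberField N] (m : ℕ) :
    ((((Nat.primesLE m).filter (fun p : ℕ => (p : ℤ) ∣ NumberField.discr N)).card : ℕ) : ℝ) ≤
      2 * Real.log ((NumberField.discr N).natAbs : ℝ) := by
  have hsum := sum_primesLE_filter_dvd_discr_log_le N m
  have hlog2 : (1 : ℝ) / 2 ≤ Real.log 2 := by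
    have := Real.log_two_gt_d9; linarith
  have hcard : ((((Nat.primesLE m).filter (fun p : ℕ => (p : ℤ) ∣ NumberField.discr N)).card : ℕ) : ℝ) *
      Real.log 2 ≤ ∑ p ∈ (Nat.primesLE m).filter (fun p : ℕ => (p : ℤ) ∣ NumberField.discr N), Real.log p := by
    rw [← nsmul_eq_mul, ← Finset.sum_const]
    refine Finset.sum_le_sum fun p hp => ?_
    have hp2 := (Nat.mem_primesLE.mp (Finset.mem_filter.mp hp).1).2.two_le
    exact Real.log_le_log (by norm_num) (by exact_mod_cast hp2)
  nlinarith [Nat.cast_nonneg (α := ℝ)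
    (((Nat.primesLE m).filter (fun p : ℕ => (p : ℤ) ∣ NumberField.discr N)).card)]

/-- Two predicates that agree outside an exceptional predicate `R` have counts differing by at most the
count of `R`. -/
theorem abs_card_filter_sub_card_filter_le (s : Finset ℕ) (P Q R : ℕ → Prop) [DecidablePred P]
    [DecidablePred Q] [DecidablePred R] (h : ∀ p ∈ s, ¬ R p → (P p ↔ Q p)) :
    |(((s.filter P).card : ℕ) : ℝ) - (s.filter Q).card| ≤ (s.filter R).card := by
  have h1 : (s.filter P).card ≤ (s.filter Q).card + (s.filter R).card := by
    calc (s.filter P).card ≤ (s.filter Q ∪ s.filter R).card := by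
          refine Finset.card_le_card fun p hp => ?_
          rw [Finset.mem_filter] at hp
          rw [Finset.mem_union, Finset.mem_filter, Finset.mem_filter]
          by_cases hR : R p
          · exact Or.inr ⟨hp.1, hR⟩
          · exact Or.inl ⟨hp.1, (h p hp.1 hR).mp hp.2⟩
      _ ≤ (s.filter Q).card + (s.filter R).card := Finset.card_union_le _ _
  have h2 : (s.filter Q).card ≤ (s.filter P).card + (s.filter R).card := by
    calc (s.filter Q).card ≤ (s.filter P ∪ s.filter R).card := by
          refine Finset.card_le_card fun p hp => ?_
          rw [Finset.mem_filter] at hp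
          rw [Finset.mem_union, Finset.mem_filter, Finset.mem_filter]
          by_cases hR : R p
          · exact Or.inr ⟨hp.1, hR⟩
          · exact Or.inl ⟨hp.1, (h p hp.1 hR).mpr hp.2⟩
      _ ≤ (s.filter P).card + (s.filter R).card := Finset.card_union_le _ _
  rw [abs_sub_le_iff]
  constructor
  · have : (((s.filter P).card : ℕ) : ℝ) ≤ (((s.filter Q).card : ℕ) : ℝ) + (s.filter R).card := by
      exact_mod_cast h1
    linarith
  · have : (((s.filter Q).card : ℕ) : ℝ) ≤ (((s.filter P).card : ℕ) : ℝ) + (s.filter R).card := by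
      exact_mod_cast h2
    linarith

/-- Absorption of an additive perturbation into a relative error: if `|a − m| ≤ ε₀ m`, `|b − a| ≤ R` and
`R ≤ ε₀ m`, then `|b − m| ≤ 2 ε₀ m`. -/
theorem abs_sub_le_of_perturb {a b m R ε₀ : ℝ} (ha : |a - m| ≤ ε₀ * m) (hb : |b - a| ≤ R)
    (hR : R ≤ ε₀ * m) : |b - m| ≤ 2 * ε₀ * m := by
  have := abs_sub_le b a m
  linarith

/-! ### The theorem -/

set_option maxHeartbeats 4000000 in
/-- **The division prime number theorem for an arbitrary prime predicate agreeing with the Frobenius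
condition at the unramified primes** (see the module docstring): for `n > 1`, `0 < ε ≤ 1`, `c' > 0` there
are `L > 0` and `0 < c ≤ min c' (1/4)` such that for every Galois number field `N` of degree `n`, every
`σ ∈ Gal(N/ℚ)`, every predicate `P` with `P(p) ↔ (∃ Q ∣ p` with trivial inertia and Frobenius `φ`,
`⟨gφg⁻¹⟩ = ⟨σ⟩)` for all primes `p ∤ d_N`, and every `x ≥ |d_N|^L` (`δ = |Div σ|/|G|`,
`π_P(x) = #{p ≤ x : P(p)}`, `Li = offsetLogIntegral`): (A) no real zero of `ζ_N` in
`(1 − c/(log|d_N| + log 4), 1)` ⟹ `|π_P(x) − δ Li(x)| ≤ ε δ Li(x)`; (B) `β₁` such a zero ⟹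
`|π_P(x) − δ(Li(x) ∓ Li(x^{β₁}))| ≤ ε δ (Li(x) ∓ Li(x^{β₁}))`, sign `−` iff `ζ_{N^{⟨σ⟩}}(β₁) = 0`.  Unconditional.
[cite: LagariasMontgomeryOdlyzko1979, Theorem 1.1] [cite: ThornerZaman2019, Theorem 1.4] -/
theorem division_PNT_pi_congr (n : ℕ) (hn : 1 < n) {ε : ℝ} (hε : 0 < ε) (hε1 : ε ≤ 1) {c' : ℝ}
    (hc' : 0 < c') :
    ∃ L c : ℝ, 0 < L ∧ 0 < c ∧ c ≤ c' ∧ c ≤ 1 / 4 ∧ ∀ (N : Type) [Field N] [NumberField N] [IsGalois ℚ N],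
      Module.finrank ℚ N = n → ∀ σ : N ≃ₐ[ℚ] N, ∀ (P : ℕ → Prop) [DecidablePred P],
        (∀ p : ℕ, p.Prime → ¬ ((p : ℤ) ∣ NumberField.discr N) →
          (P p ↔ ∃ (Q : Ideal (𝓞 N)) (_ : Q.IsMaximal) (_ : Q.LiesOver (span {(p : ℤ)})) (φ g : N ≃ₐ[ℚ] N),
            IsArithFrobAt ℤ φ Q ∧ Q.inertia (N ≃ₐ[ℚ] N) = ⊥ ∧
              Subgroup.zpowers (g * φ * g⁻¹) = Subgroup.zpowers σ)) →
        ((¬ ∃ β₁ : ℝ, dedekindZeta₁ N β₁ = 0 ∧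
            1 - c / (Real.log ((NumberField.discr N).natAbs : ℝ) + Real.log 4) < β₁ ∧ β₁ < 1) →
          ∀ x : ℝ, ((NumberField.discr N).natAbs : ℝ) ^ L ≤ x →
            |((((Nat.primesLE ⌊x⌋₊).filter P).card : ℕ) : ℝ) -
              (Nat.card {τ : N ≃ₐ[ℚ] N // ∃ g : N ≃ₐ[ℚ] N,
                  Subgroup.zpowers (g * τ * g⁻¹) = Subgroup.zpowers σ} : ℝ) / Nat.card (N ≃ₐ[ℚ] N) *
                offsetLogIntegral x| ≤
              ε * ((Nat.card {τ : N ≃ₐ[ℚ] N // ∃ g : N ≃ₐ[ℚ] N,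
                  Subgroup.zpowers (g * τ * g⁻¹) = Subgroup.zpowers σ} : ℝ) / Nat.card (N ≃ₐ[ℚ] N) *
                offsetLogIntegral x)) ∧
        (∀ β₁ : ℝ, dedekindZeta₁ N β₁ = 0 →
          1 - c / (Real.log ((NumberField.discr N).natAbs : ℝ) + Real.log 4) < β₁ → β₁ < 1 →
          (dedekindZeta₁ (IntermediateField.fixedField (Subgroup.zpowers σ)) β₁ = 0 →
            ∀ x : ℝ, ((NumberField.discr N).natAbs : ℝ) ^ L ≤ x →
              |((((Nat.primesLE ⌊x⌋₊).filter P).card : ℕ) : ℝ) -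
                (Nat.card {τ : N ≃ₐ[ℚ] N // ∃ g : N ≃ₐ[ℚ] N,
                    Subgroup.zpowers (g * τ * g⁻¹) = Subgroup.zpowers σ} : ℝ) / Nat.card (N ≃ₐ[ℚ] N) *
                  (offsetLogIntegral x - offsetLogIntegral (x ^ β₁))| ≤
                ε * ((Nat.card {τ : N ≃ₐ[ℚ] N // ∃ g : N ≃ₐ[ℚ] N,
                    Subgroup.zpowers (g * τ * g⁻¹) = Subgroup.zpowers σ} : ℝ) / Nat.card (N ≃ₐ[ℚ] N) *
                  (offsetLogIntegral x - offsetLogIntegral (x ^ β₁)))) ∧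
          (dedekindZeta₁ (IntermediateField.fixedField (Subgroup.zpowers σ)) β₁ ≠ 0 →
            ∀ x : ℝ, ((NumberField.discr N).natAbs : ℝ) ^ L ≤ x →
              |((((Nat.primesLE ⌊x⌋₊).filter P).card : ℕ) : ℝ) -
                (Nat.card {τ : N ≃ₐ[ℚ] N // ∃ g : N ≃ₐ[ℚ] N,
                    Subgroup.zpowers (g * τ * g⁻¹) = Subgroup.zpowers σ} : ℝ) / Nat.card (N ≃ₐ[ℚ] N) *
                  (offsetLogIntegral x + offsetLogIntegral (x ^ β₁))| ≤
                ε * ((Nat.card {τ : N ≃ₐ[ℚ] N // ∃ g : N ≃ₐ[ℚ] N,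
                    Subgroup.zpowers (g * τ * g⁻¹) = Subgroup.zpowers σ} : ℝ) / Nat.card (N ≃ₐ[ℚ] N) *
                  (offsetLogIntegral x + offsetLogIntegral (x ^ β₁))))) := by
  classical
  have hn0 : (0 : ℝ) < n := by exact_mod_cast (lt_trans Nat.zero_lt_one hn)
  set ε₀ : ℝ := ε / 2 with hε₀
  have hε₀0 : 0 < ε₀ := by positivity
  have hε₀1 : ε₀ ≤ 1 := by rw [hε₀]; linarith
  obtain ⟨L₀, c, hL₀, hc, hcc', hc4, h⟩ := division_PNT_pi_window n hn hε₀0 hε₀1 hc'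
  obtain ⟨c₁, hc₁, hc₁1, hMT⟩ := exceptional_mainTerm_ge n hn
  set e : ℝ := (1 : ℝ) + n * n with he
  set K : ℝ := 16 * n / (ε * c₁) with hK
  have hK1 : 1 ≤ K := by
    rw [hK, le_div_iff₀ (by positivity)]
    have hn1 : (1 : ℝ) ≤ n := by exact_mod_cast hn.le
    nlinarith [mul_le_mul hε1 hc₁1 hc₁.le zero_le_one]
  obtain ⟨L, hL, hthr⟩ := pi_thresholds L₀ (e + 1 / 2) hK1
  refine ⟨L, c, hL, hc, hcc', hc4, fun N _ _ _ hN σ P _ hP => ?_⟩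
  obtain ⟨hA, hB⟩ := h N hN σ
  have hN1 : 1 < Module.finrank ℚ N := by rw [hN]; exact hn
  set d : ℝ := ((NumberField.discr N).natAbs : ℝ) with hd
  have hd3 : (3 : ℝ) ≤ d := three_le_natAbs_discr_real N hN1
  have hd0 : (0 : ℝ) < d := by linarith
  have hd1 : (1 : ℝ) ≤ d := by linarith
  obtain ⟨hδ0, hδ1⟩ := divisionDensity_pos_le_one σ
  set δ : ℝ := (Nat.card {τ : N ≃ₐ[ℚ] N // ∃ g : N ≃ₐ[ℚ] N,
      Subgroup.zpowers (g * τ * g⁻¹) = Subgroup.zpowers σ} : ℝ) / Nat.card (N ≃ₐ[ℚ] N) with hδ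
  have hδn : 1 / (n : ℝ) ≤ δ := by
    rw [hδ, ← hN, ← IsGalois.card_aut_eq_finrank]
    apply div_le_div_of_nonneg_right _ (by positivity)
    exact_mod_cast one_le_card_division σ
  set Pgood : ℕ → Prop := fun p : ℕ => ¬ ((p : ℤ) ∣ NumberField.discr N) ∧
      ∃ (Q : Ideal (𝓞 N)) (_ : Q.IsMaximal) (_ : Q.LiesOver (span {(p : ℤ)})) (φ g : N ≃ₐ[ℚ] N),
        IsArithFrobAt ℤ φ Q ∧ Q.inertia (N ≃ₐ[ℚ] N) = ⊥ ∧
          Subgroup.zpowers (g * φ * g⁻¹) = Subgroup.zpowers σ with hPgood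
  -- the perturbation: `|π_P(x) − π(x)| ≤ #{p ≤ x : p ∣ d_N} ≤ 2 log d`
  have hpert : ∀ x : ℝ, |((((Nat.primesLE ⌊x⌋₊).filter P).card : ℕ) : ℝ) -
      (((Nat.primesLE ⌊x⌋₊).filter Pgood).card : ℕ)| ≤ 2 * Real.log d := by
    intro x
    refine le_trans (abs_card_filter_sub_card_filter_le (Nat.primesLE ⌊x⌋₊) P Pgood
      (fun p : ℕ => (p : ℤ) ∣ NumberField.discr N) fun p hp hR => ?_) ?_
    · rw [hP p (Nat.mem_primesLE.mp hp).2 hR, hPgood]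
      exact ⟨fun h1 => ⟨hR, h1⟩, fun h1 => h1.2⟩
    · convert card_filter_primesLE_dvd_discr_le N ⌊x⌋₊ using 3
  -- the absorption threshold: for `x ≥ d^L` and any `M ≥ c₁ x/(4 d^{2e} log x)`: `2 log d ≤ ε₀ δ M`
  have key : ∀ x : ℝ, d ^ L ≤ x → 256 ≤ x ∧ d ^ L₀ ≤ x ∧ 1 < x ∧ 16 ≤ Real.log x ∧
      ∀ M : ℝ, x * c₁ / (4 * d ^ (2 * e)) / Real.log x ≤ M → 2 * Real.log d ≤ ε₀ * (δ * M) := by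
    intro x hx
    obtain ⟨hx256, hxL₀, hx16, hKx⟩ := hthr d hd3 x hx
    refine ⟨hx256, hxL₀, by linarith, hx16, fun M hM => ?_⟩
    have hx0 : 0 < x := by linarith
    have hlogx0 : 0 < Real.log x := by linarith
    have hD0 : 0 < d ^ (2 * e) := Real.rpow_pos_of_pos hd0 _
    have hsx : Real.sqrt x * Real.sqrt x = x := Real.mul_self_sqrt hx0.le
    have hsx4 : 4 * Real.sqrt x ≤ x := by
      have h16 : 16 ≤ Real.sqrt x := by
        rw [show (16 : ℝ) = Real.sqrt 256 by
          rw [show (256 : ℝ) = 16 ^ 2 by norm_num, Real.sqrt_sq (by norm_num)]]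
        exact Real.sqrt_le_sqrt hx256
      nlinarith
    -- `d^{2(e+1/2)} = d^{2e} · d`
    have hsplit : d ^ (2 * (e + 1 / 2)) = d ^ (2 * e) * d := by
      rw [show 2 * (e + 1 / 2) = 2 * e + 1 by ring, Real.rpow_add hd0, Real.rpow_one]
    rw [hsplit, hK] at hKx
    -- `16 n d^{2e} d log x ≤ 4 ε c₁ √x ≤ ε c₁ x`
    have h1 : 16 * n * (d ^ (2 * e) * d) * Real.log x ≤ ε * c₁ * (4 * Real.sqrt x) := by
      have := hKx
      rw [show 16 * (n : ℝ) / (ε * c₁) * (d ^ (2 * e) * d) * Real.log x =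
        (16 * n * (d ^ (2 * e) * d) * Real.log x) / (ε * c₁) by ring, div_le_iff₀ (by positivity)] at this
      linarith
    have h2 : 16 * n * (d ^ (2 * e) * d) * Real.log x ≤ ε * c₁ * x := by
      have := mul_le_mul_of_nonneg_left hsx4 (show 0 ≤ ε * c₁ by positivity)
      linarith
    have hlogd : Real.log d ≤ d := (Real.log_le_sub_one_of_pos hd0).trans (by linarith)
    have hlogd0 : 0 < Real.log d := Real.log_pos (by linarith)
    -- `δ M ≥ (1/n) · c₁ x/(4 d^{2e} log x)`
    have hM0 : 0 ≤ x * c₁ / (4 * d ^ (2 * e)) / Real.log x := by positivity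
    have hδM : 1 / (n : ℝ) * (x * c₁ / (4 * d ^ (2 * e)) / Real.log x) ≤ δ * M :=
      mul_le_mul hδn hM (hM0) hδ0.le
    have h3 : 2 * Real.log d ≤ ε₀ * (1 / (n : ℝ) * (x * c₁ / (4 * d ^ (2 * e)) / Real.log x)) := by
      rw [hε₀, show ε / 2 * (1 / (n : ℝ) * (x * c₁ / (4 * d ^ (2 * e)) / Real.log x)) =
        (ε * c₁ * x) / (8 * n * d ^ (2 * e) * Real.log x) by field_simp; ring,
        le_div_iff₀ (by positivity)]
      have h4 : 2 * Real.log d * (8 * n * d ^ (2 * e) * Real.log x) =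
          Real.log d * (16 * n * d ^ (2 * e) * Real.log x) := by ring
      rw [h4]
      calc Real.log d * (16 * n * d ^ (2 * e) * Real.log x)
          ≤ d * (16 * n * d ^ (2 * e) * Real.log x) :=
            mul_le_mul_of_nonneg_right hlogd (by positivity)
        _ = 16 * n * (d ^ (2 * e) * d) * Real.log x := by ring
        _ ≤ ε * c₁ * x := h2
    exact h3.trans (mul_le_mul_of_nonneg_left hδM hε₀0.le)
  refine ⟨?_, ?_⟩
  · -- (A)
    intro hexc x hx
    obtain ⟨hx256, hxL₀, hx1, hx16, hkey⟩ := key x hx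
    have hmain := hA hexc x hxL₀
    have hLi : x * c₁ / (4 * d ^ (2 * e)) / Real.log x ≤ offsetLogIntegral x := by
      refine le_trans ?_ (div_two_mul_log_le_offsetLogIntegral hx256)
      have hlogx0 : 0 < Real.log x := by linarith
      have hx0 : 0 < x := by linarith
      have hD1 : 1 ≤ d ^ (2 * e) := Real.one_le_rpow hd1 (by positivity)
      rw [div_div, div_le_div_iff₀ (by positivity) (by positivity)]
      nlinarith [mul_le_mul_of_nonneg_left hD1 hx0.le, mul_pos hx0 hlogx0]
    have := abs_sub_le_of_perturb hmain (hpert x) (hkey _ hLi)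
    rw [hε₀] at this
    convert this using 2; ring
  · -- (B)
    intro β₁ hζ₁ hβ₁c hβ₁1
    obtain ⟨hB1, hB2⟩ := hB β₁ hζ₁ hβ₁c hβ₁1
    have hβ34 : 3 / 4 ≤ β₁ := three_quarters_le_of_window hc hc4 hd3 hβ₁c
    have hβ0 : 0 < β₁ := by linarith
    refine ⟨?_, ?_⟩
    · -- (B1)
      intro hζσ x hx
      obtain ⟨hx256, hxL₀, hx1, hx16, hkey⟩ := key x hx
      have hmain := hB1 hζσ x hxL₀
      have hx0 : 0 < x := by linarith
      have hlogx0 : 0 < Real.log x := by linarith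
      have hLi : x * c₁ / (4 * d ^ (2 * e)) / Real.log x ≤
          offsetLogIntegral x - offsetLogIntegral (x ^ β₁) := by
        refine le_trans ?_ (sub_rpow_div_log_le_offsetLogIntegral_sub hx1 hβ0 hβ₁1.le)
        apply div_le_div_of_nonneg_right _ hlogx0.le
        have h1 := hMT N hN β₁ hζ₁ hβ34 hβ₁1 x hx1 hx16
        have h2 : x ^ β₁ ≤ x ^ β₁ / β₁ := by
          rw [le_div_iff₀ hβ0]
          have := Real.rpow_pos_of_pos hx0 β₁
          nlinarith
        linarith
      have := abs_sub_le_of_perturb hmain (hpert x) (hkey _ hLi)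
      rw [hε₀] at this
      convert this using 2; ring
    · -- (B2)
      intro hζσ x hx
      obtain ⟨hx256, hxL₀, hx1, hx16, hkey⟩ := key x hx
      have hmain := hB2 hζσ x hxL₀
      have hx0 : 0 < x := by linarith
      have hlogx0 : 0 < Real.log x := by linarith
      have hLi : x * c₁ / (4 * d ^ (2 * e)) / Real.log x ≤
          offsetLogIntegral x + offsetLogIntegral (x ^ β₁) := by
        have h0 : 0 ≤ offsetLogIntegral (x ^ β₁) := by
          have h2 : (2 : ℝ) ≤ x ^ β₁ := by
            have h64 : (256 : ℝ) ^ (3 / 4 : ℝ) ≤ x ^ β₁ :=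
              (Real.rpow_le_rpow (by norm_num) hx256 (by norm_num)).trans
                (Real.rpow_le_rpow_of_exponent_le hx1.le hβ34)
            have : (2 : ℝ) ≤ (256 : ℝ) ^ (3 / 4 : ℝ) := by
              rw [show (256 : ℝ) = 4 ^ (4 : ℝ) by norm_num, ← Real.rpow_mul (by norm_num)]
              norm_num
            linarith
          have := offsetLogIntegralPow_nonneg 1 h2
          rwa [offsetLogIntegralPow_one] at this
        refine le_trans ?_ ((div_two_mul_log_le_offsetLogIntegral hx256).trans (le_add_of_nonneg_right h0))
        have hD1 : 1 ≤ d ^ (2 * e) := Real.one_le_rpow hd1 (by positivity)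
        rw [div_div, div_le_div_iff₀ (by positivity) (by positivity)]
        nlinarith [mul_le_mul_of_nonneg_left hD1 hx0.le, mul_pos hx0 hlogx0]
      have := abs_sub_le_of_perturb hmain (hpert x) (hkey _ hLi)
      rw [hε₀] at this
      convert this using 2; ring

end Summit.QuantumAdvantage.QuantumAdvantage.Theorems.DegreeOnePrimesEscape

end
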